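import Summits.Ventures.PackingBounds.ThreePointCert.SoundDim3
import Summits.Ventures.PackingBounds.ThreePointCert.CheckKron
import Summits.Ventures.PackingBounds.ThreePointCert.T16d11ExpandR0p1
import Summits.Ventures.PackingBounds.ThreePointCert.T16d11ExpandR0p2
import Summits.Ventures.PackingBounds.ThreePointCert.T16d11ExpandR0p3
import Summits.Ventures.PackingBounds.ThreePointCert.T16d11ExpandR1p1
import Summits.Ventures.PackingBounds.ThreePointCert.T16d11ExpandR1p2
import Summits.Ventures.PackingBounds.ThreePointCert.T16d11ExpandR2p1
import Summits.Ventures.PackingBounds.ThreePointCert.T16d11ExpandR3p1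
import Summits.Ventures.PackingBounds.ThreePointCert.T16d11ExpandR4p1
import Summits.Ventures.PackingBounds.ThreePointCert.T16d11ExpandQG1
import Summits.Ventures.PackingBounds.ThreePointCert.T16d11ExpandQG2
import Summits.Ventures.PackingBounds.ThreePointCert.T16d11ExpandQG3
import Summits.Ventures.PackingBounds.ThreePointCert.T16d11ExpandQG4
import Summits.Ventures.PackingBounds.ThreePointCert.T16d11ExpandQG5
import Summits.Ventures.PackingBounds.ThreePointCert.T16d11ExpandQG6
import Summits.Ventures.PackingBounds.ThreePointCert.T16d11ExpandQG7
import Summits.Ventures.PackingBounds.ThreePointCert.T16d11ExpandQG8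
import Summits.Ventures.PackingBounds.ThreePointCert.T16d11ExpandQG9
import Summits.Ventures.PackingBounds.ThreePointCert.T16d11ExpandQG10
import Summits.Ventures.PackingBounds.ThreePointCert.T16d11ExpandQG11
import Summits.Ventures.PackingBounds.ThreePointCert.T16d11ExpandQG12
import Summits.Ventures.PackingBounds.ThreePointCert.T16d11ExpandQG13

/-!
# Tammes θ(16) ≤ arccos(374/625) = 53.2447° (A(3, 374/625) ≤ 15): the kernel-checked theorem

Framing: lottery ticket; floor = certified bounds/negative ranges. Venture `PackingBounds` (cell
`pub-packcert`), three-point SDP family. Integer data of a feasible point of the Bachoc–Vallentin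
semidefinite program (n = 3, s = 374/625, degree d = 11, Bachoc–Vallentin
multiplier set = cell mode sym2), derived by `cert2lean_s2.py` (sdp gen 5 fork of cert2lean_lp.py) from the exact rational certificate
`sdp-n3-d11-s374-625-sym2f-lpclient-v1.json` of the cell (exact verifier #1 + verifier #2 of the other seat), in the units of the kernel
checker `ThreePointCert.Check` + `CheckSym2` (soundness `card_le_of_cert3S2`); Gram factors offset-encoded for the
Kronecker-packed chunk validation `ThreePointCert.CheckKron` (emitter `emitleanS2.py` = lp gen 3 emitleanK.py). Generated file: plain
lists of integers / monomials.
-/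

namespace Summit.Ventures.PackingBounds.ThreePointCert.T16d11

open Literature.Geometry.DiscreteGeometry Literature.Geometry.DiscreteGeometry.PolyCert PolyCert.SPoly

set_option maxRecDepth 100000 in
/-- All expansion data are valid (assembled from the kernel validations). -/
theorem polys_ok : PolysOK33 T16d11.cert T16d11.polys T16d11.gR0 T16d11.gR1 T16d11.gR2 T16d11.gR3 T16d11.gR4 T16d11.gQ0 T16d11.gQ1 where
  hF := fexpValid3_of_fchunkVal cert eFP _ (by rfl) (fchunkVal3_append _ _ _ _ _ _ (fchunkVal3_append _ _ _ _ _ _ (fchunkVal3_append _ _ _ _ _ _ (fchunkVal3_append _ _ _ _ _ _ (fchunkVal3_append _ _ _ _ _ _ (fchunkVal3_append _ _ _ _ _ _ (fchunkVal3_append _ _ _ _ _ _ (fchunkVal3_append _ _ _ _ _ _ (fchunkVal3_append _ _ _ _ _ _ (fchunkVal3_append _ _ _ _ _ _ (fchunkVal3_of_ok _ _ _ _ okF_1) (fchunkVal3_of_ok _ _ _ _ okF_2)) (fchunkVal3_of_ok _ _ _ _ okF_3)) (fchunkVal3_of_ok _ _ _ _ okF_4)) (fchunkVal3_of_ok _ _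 _ _ okF_5)) (fchunkVal3_of_ok _ _ _ _ okF_6)) (fchunkVal3_of_ok _ _ _ _ okF_7)) (fchunkVal3_of_ok _ _ _ _ okF_8)) (fchunkVal3_of_ok _ _ _ _ okF_9)) (fchunkVal3_of_ok _ _ _ _ okF_10)) (fchunkVal3_of_ok _ _ _ _ okF_11))
  h0 := by
    have c := chunkVal_of_okK _ _ _ _ _ okR0_1
    have c := chunkVal_trans _ _ _ _ _ _ _ c (chunkVal_of_okK _ _ _ _ _ okR0_2)
    have c := chunkVal_trans _ _ _ _ _ _ _ c (chunkVal_of_okK _ _ _ _ _ okR0_3)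
    have c := chunkVal_trans _ _ _ _ _ _ _ c (chunkVal_of_okK _ _ _ _ _ okR0_4)
    have c := chunkVal_trans _ _ _ _ _ _ _ c (chunkVal_of_okK _ _ _ _ _ okR0_5)
    have c := chunkVal_trans _ _ _ _ _ _ _ c (chunkVal_of_okK _ _ _ _ _ okR0_6)
    exact c
  h1 := by
    have c := chunkVal_of_okK _ _ _ _ _ okR1_1
    have c := chunkVal_trans _ _ _ _ _ _ _ c (chunkVal_of_okK _ _ _ _ _ okR1_2)
    have c := chunkVal_trans _ _ _ _ _ _ _ c (chunkVal_of_okK _ _ _ _ _ okR1_3)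
    exact c
  h2 := rvalid_of_singleK gR2K eR2 okR2_1
  h3 := rvalid_of_singleK gR3K eR3 okR3_1
  h4 := by
    have c := chunkVal_of_okK _ _ _ _ _ okR4_1
    have c := chunkVal_trans _ _ _ _ _ _ _ c (chunkVal_of_okK _ _ _ _ _ okR4_2)
    exact c
  hq0 := rvalid_of_singleK gQ0K eQ0 okQ0_1
  hq1 := rvalid_of_singleK gQ1K eQ1 okQ1_1

set_option maxHeartbeats 0 in
/-- The side conditions hold. -/
theorem cert_side : checkSide33 T16d11.cert = true := by decide +kernel

set_option maxHeartbeats 0 in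
/-- The numerical bound is `< N + 1` (and `≥ 0`). -/
theorem cert_bound : checkBound3 T16d11.cert T16d11.polys = true := by decide +kernel

set_option maxRecDepth 100000 in
set_option maxHeartbeats 0 in
/-- The certificate passes the check of constraint `(i')`. -/
theorem cert_I : checkI3 T16d11.cert T16d11.polys = true := by decide +kernel

set_option maxRecDepth 100000 in
set_option maxHeartbeats 0 in
/-- The certificate passes the check of constraint `(ii')` (Bachoc–Vallentin multiplier set). -/
theorem cert_II : checkII3S2 T16d11.cert T16d11.polys = true := by decide +kernel

/-- **Tammes θ(16) ≤ arccos(374/625) = 53.2447° (A(3, 374/625) ≤ 15)**: every set of `16` unit vectors of `ℝ³` contains two distinct vectors with inner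
product `> 374 / 625`, i.e. at angle `< arccos(374 / 625)`; equivalently `A(3, 374 / 625) ≤ 15` — a certified
upper bound for the Tammes problem, `θ(16) ≤ arccos(374 / 625)`. Bachoc–Vallentin three-point (semidefinite
programming) bound on `S²` (Chebyshev kernels), their multiplier set, degree 11, from an exact certificate (bound value 15.959363),
kernel-checked. [cite: BachocVallentin2007, Theorem 4.2; BachocVallentin2007ISIT, Table 5.3] -/
theorem tammes16_card_le_15_sdp (C : Finset (EuclideanSpace ℝ (Fin 3)))
    (h1 : ∀ x ∈ C, ‖x‖ = 1) (h2 : ∀ x ∈ C, ∀ y ∈ C, x ≠ y → inner ℝ x y ≤ 374 / 625) :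
    C.card ≤ 15 :=
  card_le_of_cert33S2 cert polys polys_ok cert_I cert_II cert_side cert_bound C h1
    (fun x hx y hy hxy => by
      have h := h2 x hx y hy hxy
      have e : ((cert.p : ℤ) : ℝ) / (cert.q : ℕ) = 374 / 625 := by norm_num [cert]
      rw [e]; exact h)

end Summit.Ventures.PackingBounds.ThreePointCert.T16d11
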